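import Summits.BirchSwinnertonDyer.BirchSwinnertonDyer.Theorems.PrintCf2SplitBadTwoLineUniqueness
import Literature.NumberTheory.EllipticCurves.IwasawaCyclotomicProofs
import Literature.NumberTheory.EllipticCurves.ZpExtensionUnramifiedProofs
import Literature.NumberTheory.GaloisRepresentations.CocyclicScalarCharacter
import Literature.NumberTheory.GaloisRepresentations.AbsGaloisGroupCompact
import HarnessLib

/-!
# Crux `PrintCf2.SplitBadTwoRankOneOfFacts` (stmt-BirchSwinnertonDyer-20368), road α v10.3 — the class-field-theoretic input (C3), part 2:
# **EVERY `ℤ_p`-LINE UNRAMIFIED OUTSIDE `v̄` IS CUT OUT BY ANY SCALAR CHARACTER UNRAMIFIED-MOD-TORSION OUTSIDE `v̄`: `ker κ' = χ⁻¹((ℤ_pˣ)_tors)`**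

Cell `bsd-print-cf2`, width seat `bsd-line-cf2-p1-w6` g3 (prover-bsd-line-cf2-p1-w6-g3-0). `--supports stmt-BirchSwinnertonDyer-20368`
(helper, Theses-free). HONEST FRAMING: nothing here closes the crux or a registered stub; BSD is not proved by any of this; no summit
statement is proved by this seat. No definition, no named fact, no `sorry`.

WHAT. Part 1 (`…LineUniqueness`, `kerSubgroup_eq_of_isUnramifiedOutside`) proved that two `ℤ_p`-lines of an imaginary quadratic `K`
unramified outside a split prime `v̄` have the same kernel. This file turns a CHARACTER into such a line and reads off the kernel:
* §1 `exists_zpExtension_kerSubgroup_eq_comap_torsion` (ANY field `K`, ANY `p`): a continuous `χ : Γ_K →ₜ* ℤ_pˣ` with ONE value outside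
  the torsion `μ(ℤ_p)` yields a `ℤ_p`-extension `κ_χ` with `ker κ_χ = χ⁻¹(μ(ℤ_p))` — the tree's `exists_isCyclotomic_holds` verbatim with `χ`
  for the cyclotomic character (logarithm `L : ℤ_pˣ → ℤ_p` with `ker L = μ(ℤ_p)`, saturation `exists_surjective_of_ne_one`).
* §2 **`kerSubgroup_eq_comap_torsion_of_isUnramifiedOutside`** (`K` imaginary quadratic, `v ≠ v̄` above `p`): if moreover `χ(I_w) ⊆ μ(ℤ_p)`
  at the places `w ∣ p`, `w ≠ v̄`, then `κ_χ` is unramified outside `v̄` (at `w ∤ p` by Washington 13.2, tree `inertia_le_kerSubgroup_holds`),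
  so by part 1 **`ker κ' = χ⁻¹(μ(ℤ_p))` for EVERY `ℤ_p`-extension `κ'` unramified outside `v̄`**.
* §3 scalar actions (ANY group `G` acting on a `p`-primary `M` with elements of every order `p^k` through a function `ψ : G → ℤ_pˣ`,
  the currency of the tree's `CocyclicScalar.exists_continuousMonoidHom_forall_smul_eq`): `σ` acts as `+1` iff `ψ σ = 1`
  (`forall_smul_eq_self_iff`), as `−1` iff `ψ σ = −1` (`forall_smul_eq_neg_iff`), and POINTWISE `±1` already forces `ψ σ = ±1`
  (`eq_one_or_eq_neg_one_of_forall_smul_eq_or`); `μ(ℤ₂) = {±1}` (`mem_torsion_units_two_iff`).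
* §4 **`mem_kerSubgroup_iff_smul_of_scalarAction_two`** (`p = 2`, (C3) ABSTRACTLY): for `Γ_K` acting on such an `M` with open
  stabilisers, inertia at the places `w ∣ 2`, `w ≠ v̄` acting pointwise as `±1`, and SOME `σ` acting neither as `+1` nor as `−1`:
  **`σ ∈ ker κ' ↔ (σ acts as +1 on M) ∨ (σ acts as −1 on M)`** for every `ℤ₂`-extension `κ'` unramified outside `v̄` and every `σ ∈ Γ_K`.
  Part 3 instantiates `M = W* = E[𝔮_r^∞]` on the S3c frame ((C3) and -w2 g9's (C3-loc) verbatim).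
presearch: Washington 1997 §13.1 (p. 264, Thm. 13.4), Neukirch ANT V §1 Ex. 7, Serre 1968 I §1.2, de Shalit 1987 II.1.9/II.4.17 — held/cited;
B15 memo §1 (C3) (-w2 g9) is the statement; no fact filed. beyond-print theorem: no.

References: [Washington1997] §13.1; [NeukirchANT1999] Ch. V §1 Ex. 7; [SerreAbelianLadic1968] Ch. I §1.2; [Serre1973] Ch. II §3;
[deShalit1987] II §1.9, §4.17; [Agboola2007] §1.
-/

noncomputable section

open Field NumberField IsDedekindDomain

set_option linter.dupNamespace false
set_option autoImplicit false

namespace Summit.BirchSwinnertonDyer.BirchSwinnertonDyer.Theorems.PrintCf2.LineDecomposition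

open Literature.NumberTheory.GaloisRepresentations Literature.NumberTheory.NumberFields
open Literature.NumberTheory.EllipticCurves Literature.NumberTheory.EllipticCurves.ZpExtension
open Literature.GroupTheory.Abelian.PruferGroup

/-! ## §1. A `ℤ_p`-extension from a `ℤ_pˣ`-valued character -/

section AnyField

variable {K : Type} [Field K] {p : ℕ} [Fact p.Prime]

/-- **The `ℤ_p`-line of a character.** For a continuous character `χ : Γ_K →ₜ* ℤ_pˣ` of ANY field `K` taking SOME value outside the
torsion subgroup `μ(ℤ_p) = (ℤ_pˣ)_{tors}`, there is a `ℤ_p`-extension `κ : Γ_K ↠ ℤ_p` with `ker κ = χ⁻¹(μ(ℤ_p))` (the fixed field of the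
torsion of `χ(Γ_K)`): compose with the logarithm `L : ℤ_pˣ →ₜ* ℤ_p`, `ker L = μ(ℤ_p)` (tree `PadicInt.exists_continuousMonoidHom_ker_eq_torsion`),
and saturate the non-trivial `L ∘ χ` (`exists_surjective_of_ne_one`). The case `χ = χ_p` is the tree's `exists_isCyclotomic_holds`.
[cite: Washington1997, §13.1 (p. 264)] [cite: NeukirchANT1999, Ch. V §1, Exercise 7] -/
theorem exists_zpExtension_kerSubgroup_eq_comap_torsion (χ : absoluteGaloisGroup K →ₜ* ℤ_[p]ˣ)
    (hχ : ∃ σ : absoluteGaloisGroup K, χ σ ∉ CommGroup.torsion ℤ_[p]ˣ) :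
    ∃ κ : ZpExtension K p, κ.kerSubgroup = (CommGroup.torsion ℤ_[p]ˣ).comap χ.toMonoidHom := by
  haveI : CompactSpace (absoluteGaloisGroup K) := absoluteGaloisGroup_compactSpace K
  obtain ⟨L, hL⟩ := PadicInt.exists_continuousMonoidHom_ker_eq_torsion (p := p)
  set f : absoluteGaloisGroup K →ₜ* Multiplicative ℤ_[p] := L.comp χ with hf
  have hfapply : ∀ σ, f σ = L (χ σ) := fun σ => rfl
  have hf1 : f ≠ 1 := by
    intro h1
    obtain ⟨σ, hσ⟩ := hχ
    apply hσ
    rw [← hL, MonoidHom.mem_ker]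
    show L (χ σ) = 1
    rw [← hfapply, h1]
    rfl
  obtain ⟨g, k, hg, hgf⟩ := exists_surjective_of_ne_one f hf1
  refine ⟨⟨g, hg⟩, ?_⟩
  show g.toMonoidHom.ker = (CommGroup.torsion ℤ_[p]ˣ).comap χ.toMonoidHom
  rw [← hL]
  ext σ
  rw [MonoidHom.mem_ker, Subgroup.mem_comap, MonoidHom.mem_ker]
  show g σ = 1 ↔ L (χ σ) = 1
  rw [← hfapply, ← ofAdd_toAdd (g σ), ← ofAdd_toAdd (f σ), hgf σ, ← ofAdd_zero,
    Multiplicative.ofAdd.apply_eq_iff_eq, Multiplicative.ofAdd.apply_eq_iff_eq, mul_eq_zero,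
    or_iff_right (pow_ne_zero k (NeZero.ne (p : ℤ_[p])))]

end AnyField

/-! ## §2. With part 1: every line unramified outside `v̄` is `χ⁻¹(μ(ℤ_p))` -/

section ImaginaryQuadratic

variable {K : Type} [Field K] [NumberField K] {p : ℕ} [Fact p.Prime]

/-- **The line of a character unramified-mod-torsion outside `v̄` is unramified outside `v̄`.** If `ker κ = χ⁻¹(μ(ℤ_p))` and
`χ(I_w) ⊆ μ(ℤ_p)` at every place `w ∣ p` other than `v̄`, then `κ` is unramified outside `v̄` (at `w ∤ p` every `ℤ_p`-extension is
unramified: Washington's Prop. 13.2, tree `inertia_le_kerSubgroup_holds`). [cite: Washington1997, §13.1 Prop. 13.2] -/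
theorem isUnramifiedOutside_of_kerSubgroup_eq_comap_torsion {κ : ZpExtension K p} {χ : absoluteGaloisGroup K →ₜ* ℤ_[p]ˣ}
    (hκ : κ.kerSubgroup = (CommGroup.torsion ℤ_[p]ˣ).comap χ.toMonoidHom) {vbar : HeightOneSpectrum (𝓞 K)}
    (hI : ∀ w : HeightOneSpectrum (𝓞 K), ((p : ℕ) : 𝓞 K) ∈ w.asIdeal → w ≠ vbar →
      ∀ τ ∈ GreenbergSelmer.inertia w, χ τ ∈ CommGroup.torsion ℤ_[p]ˣ) :
    κ.IsUnramifiedOutside vbar := by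
  refine isUnramifiedOutside_of_forall_above (inertia_le_kerSubgroup_holds K p) κ vbar fun w hw hne τ hτ => ?_
  rw [hκ, Subgroup.mem_comap]
  exact hI w hw hne τ hτ

/-- **`ker κ' = χ⁻¹(μ(ℤ_p))` FOR EVERY LINE `κ'` UNRAMIFIED OUTSIDE `v̄`.** `K` imaginary quadratic, `v ≠ v̄` the places above `p`,
`χ : Γ_K →ₜ* ℤ_pˣ` continuous with a value outside `μ(ℤ_p)` and `χ(I_w) ⊆ μ(ℤ_p)` at the places `w ∣ p`, `w ≠ v̄`. Then every
`ℤ_p`-extension `κ'` of `K` unramified outside `v̄` has `ker κ' = χ⁻¹(μ(ℤ_p))`: the line of `χ` (§1) is unramified outside `v̄`, and the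
line unramified outside `v̄` is unique (part 1, `kerSubgroup_eq_of_isUnramifiedOutside`). [cite: deShalit1987, II §1.9 and §4.17]
[cite: Washington1997, §13.1 Thm. 13.4] -/
theorem kerSubgroup_eq_comap_torsion_of_isUnramifiedOutside (hK : IsImaginaryQuadratic K)
    {v vbar : HeightOneSpectrum (𝓞 K)} (hv : ((p : ℕ) : 𝓞 K) ∈ v.asIdeal) (hvbar : ((p : ℕ) : 𝓞 K) ∈ vbar.asIdeal)
    (hne : vbar ≠ v) (χ : absoluteGaloisGroup K →ₜ* ℤ_[p]ˣ) (hbig : ∃ σ : absoluteGaloisGroup K, χ σ ∉ CommGroup.torsion ℤ_[p]ˣ)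
    (hI : ∀ w : HeightOneSpectrum (𝓞 K), ((p : ℕ) : 𝓞 K) ∈ w.asIdeal → w ≠ vbar →
      ∀ τ ∈ GreenbergSelmer.inertia w, χ τ ∈ CommGroup.torsion ℤ_[p]ˣ)
    (κ' : ZpExtension K p) (hκ' : κ'.IsUnramifiedOutside vbar) :
    κ'.kerSubgroup = (CommGroup.torsion ℤ_[p]ˣ).comap χ.toMonoidHom := by
  obtain ⟨κ, hκ⟩ := exists_zpExtension_kerSubgroup_eq_comap_torsion χ hbig
  rw [← hκ]
  exact kerSubgroup_eq_of_isUnramifiedOutside hK hv hvbar hne κ κ' (isUnramifiedOutside_of_kerSubgroup_eq_comap_torsion hκ hI) hκ'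

end ImaginaryQuadratic

/-! ## §3. Scalar actions through `ψ : G → ℤ_pˣ`: acting as `+1`, as `−1`, pointwise as `±1`; `μ(ℤ₂) = {±1}` -/

section Scalar

variable {G : Type*} [Group G] {M : Type*} [AddCommGroup M] [DistribMulAction G M] {p : ℕ} [Fact p.Prime]
  (hprim : ∀ x : M, ∃ k : ℕ, p ^ k • x = 0) (hfull : ∀ k : ℕ, ∃ x : M, addOrderOf x = p ^ k)
  {ψ : G → ℤ_[p]ˣ} (hψ : ∀ (σ : G) (k : ℕ) (x : M), p ^ k • x = 0 → σ • x = (PadicInt.toZModPow k (ψ σ : ℤ_[p])).val • x)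

/-- A `p`-adic integer congruent to the integer `c` modulo every `p^k` IS `c`. [cite: Serre1973, Ch. II §1] -/
theorem eq_intCast_of_forall_toZModPow_eq {u : ℤ_[p]} {c : ℤ} (h : ∀ k : ℕ, PadicInt.toZModPow k u = (c : ZMod (p ^ k))) :
    u = c := by
  refine PadicInt.ext_of_toZModPow.mp fun k => ?_
  rw [h k, map_intCast]

include hfull hψ in
/-- If `σ` acts on all of `M` as the integer `c`, then `ψ σ = c` (read at the elements of order `p^k`, `CocyclicScalar.toZModPow_unitsChar_eq_of_smul_eq`).
[cite: SerreAbelianLadic1968, Ch. I §1.2] -/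
theorem unitsChar_eq_intCast_of_forall_smul_eq (σ : G) {c : ℤ} (h : ∀ x : M, σ • x = c • x) : (ψ σ : ℤ_[p]) = c :=
  eq_intCast_of_forall_toZModPow_eq fun k => by
    obtain ⟨x, hx⟩ := hfull k
    exact CocyclicScalar.toZModPow_unitsChar_eq_of_smul_eq hψ hx (h x)

include hprim hψ in
/-- If `ψ σ = c` is an integer, `σ` acts on all of `M` as `c`. [cite: SerreAbelianLadic1968, Ch. I §1.2] -/
theorem forall_smul_eq_of_unitsChar_eq_intCast (σ : G) {c : ℤ} (h : (ψ σ : ℤ_[p]) = c) (x : M) : σ • x = c • x := by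
  obtain ⟨k, hk⟩ := hprim x
  rw [hψ σ k x hk, h, zmod_val_toZModPow_intCast_smul (p := p) k c hk]

include hprim hfull hψ in
/-- **`σ` acts as `+1` on `M` iff `ψ σ = 1`.** [cite: SerreAbelianLadic1968, Ch. I §1.2] -/
theorem forall_smul_eq_self_iff (σ : G) : (∀ x : M, σ • x = x) ↔ ψ σ = 1 := by
  constructor
  · intro h
    have h1 := unitsChar_eq_intCast_of_forall_smul_eq hfull hψ σ (c := 1) (fun x => by rw [one_smul]; exact h x)
    exact Units.ext (by rw [h1, Int.cast_one, Units.val_one])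
  · intro h x
    have := forall_smul_eq_of_unitsChar_eq_intCast hprim hψ σ (c := 1) (by rw [h, Units.val_one, Int.cast_one]) x
    rwa [one_smul] at this

include hprim hfull hψ in
/-- **`σ` acts as `−1` on `M` iff `ψ σ = −1`.** [cite: SerreAbelianLadic1968, Ch. I §1.2] -/
theorem forall_smul_eq_neg_iff (σ : G) : (∀ x : M, σ • x = -x) ↔ ψ σ = -1 := by
  constructor
  · intro h
    have h1 := unitsChar_eq_intCast_of_forall_smul_eq hfull hψ σ (c := -1) (fun x => by rw [neg_one_zsmul]; exact h x)
    exact Units.ext (by rw [h1, Int.cast_neg, Int.cast_one, Units.val_neg, Units.val_one])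
  · intro h x
    have := forall_smul_eq_of_unitsChar_eq_intCast hprim hψ σ (c := -1)
      (by rw [h, Units.val_neg, Units.val_one, Int.cast_neg, Int.cast_one]) x
    rwa [neg_one_zsmul] at this

omit [Fact p.Prime] in
/-- A non-zero `p`-adic integer is non-zero modulo some `p^k`. [cite: Serre1973, Ch. II §1] -/
theorem exists_toZModPow_ne_zero [Fact p.Prime] {u : ℤ_[p]} (hu : u ≠ 0) : ∃ k : ℕ, PadicInt.toZModPow k u ≠ 0 := by
  obtain ⟨k, hk⟩ := PadicInt.exists_pow_neg_lt p (norm_pos_iff.mpr hu)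
  refine ⟨k, fun h => ?_⟩
  have hmem : u ∈ RingHom.ker (PadicInt.toZModPow k) := h
  rw [PadicInt.ker_toZModPow, ← PadicInt.norm_le_pow_iff_mem_span_pow] at hmem
  exact absurd (lt_of_le_of_lt hmem hk) (lt_irrefl _)

include hfull hψ in
/-- **Pointwise `±1` is `±1`.** If `σ` moves every `x ∈ M` to `x` or to `−x`, then `ψ σ = 1` or `ψ σ = −1`: at an element of order
`p^k`, `ψ σ ≡ ±1 (mod p^k)`; if `ψ σ ∉ {1, −1}` both `ψ σ − 1` and `ψ σ + 1` are non-zero modulo `p^k` for `k` large.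
[cite: SerreAbelianLadic1968, Ch. I §1.2] -/
theorem eq_one_or_eq_neg_one_of_forall_smul_eq_or (σ : G) (h : ∀ x : M, σ • x = x ∨ σ • x = -x) :
    ψ σ = 1 ∨ ψ σ = -1 := by
  by_contra hne
  rw [not_or] at hne
  have h1 : (ψ σ : ℤ_[p]) - 1 ≠ 0 := fun h0 => hne.1 (Units.ext (by rw [Units.val_one]; exact sub_eq_zero.mp h0))
  have h2 : (ψ σ : ℤ_[p]) + 1 ≠ 0 := fun h0 => hne.2 (Units.ext (by
    rw [Units.val_neg, Units.val_one]; exact eq_neg_of_add_eq_zero_left h0))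
  obtain ⟨k₁, hk₁⟩ := exists_toZModPow_ne_zero h1
  obtain ⟨k₂, hk₂⟩ := exists_toZModPow_ne_zero h2
  -- at level `k = k₁ + k₂` both residues are non-zero
  have hcast : ∀ {k j : ℕ} (hjk : j ≤ k) (u : ℤ_[p]), PadicInt.toZModPow j u = 0 → False →
      False := fun _ _ _ h => h
  have hdown : ∀ {j k : ℕ}, j ≤ k → ∀ u : ℤ_[p], PadicInt.toZModPow k u = 0 → PadicInt.toZModPow j u = 0 := by
    intro j k hjk u hu
    rw [← PadicInt.zmod_cast_comp_toZModPow j k hjk, RingHom.comp_apply, hu, map_zero]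
  obtain ⟨x, hx⟩ := hfull (k₁ + k₂)
  have hxk : p ^ (k₁ + k₂) • x = 0 := CocyclicScalar.pow_nsmul_eq_zero_of_addOrderOf hx
  rcases h x with hfix | hneg
  · -- `ψ σ ≡ 1 (mod p^(k₁+k₂))`, hence modulo `p^k₁`
    have heq : PadicInt.toZModPow (k₁ + k₂) (ψ σ : ℤ_[p]) = ((1 : ℤ) : ZMod (p ^ (k₁ + k₂))) :=
      CocyclicScalar.toZModPow_unitsChar_eq_of_smul_eq hψ hx (by rw [one_smul]; exact hfix)
    apply hk₁
    apply hdown (Nat.le_add_right k₁ k₂)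
    rw [map_sub, map_one, heq, Int.cast_one, sub_self]
  · have heq : PadicInt.toZModPow (k₁ + k₂) (ψ σ : ℤ_[p]) = ((-1 : ℤ) : ZMod (p ^ (k₁ + k₂))) :=
      CocyclicScalar.toZModPow_unitsChar_eq_of_smul_eq hψ hx (by rw [neg_one_zsmul]; exact hneg)
    apply hk₂
    apply hdown (Nat.le_add_left k₂ k₁)
    rw [map_add, map_one, heq, Int.cast_neg, Int.cast_one, neg_add_cancel]

/-- **`μ(ℤ₂) = {±1}`**: a `2`-adic unit of finite order is `±1` (`(ℤ₂ˣ)_{tors} ≤` the square roots of unity, tree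
`PadicInt.torsion_units_le_rootsOfUnity` with `torsionOrder 2 = 2`, and `ℤ₂` is a domain). [cite: Serre1973, Ch. II §3.2 Prop. 8] -/
theorem mem_torsion_units_two_iff (u : ℤ_[2]ˣ) : u ∈ CommGroup.torsion ℤ_[2]ˣ ↔ u = 1 ∨ u = -1 := by
  haveI : Fact (Nat.Prime 2) := ⟨Nat.prime_two⟩
  constructor
  · intro hu
    have h := PadicInt.torsion_units_le_rootsOfUnity (p := 2) hu
    have htor : Literature.NumberTheory.EllipticCurves.torsionOrder 2 = 2 := by
      rw [Literature.NumberTheory.EllipticCurves.torsionOrder,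
        show Literature.NumberTheory.EllipticCurves.cyclotomicExponent 2 = 2 by
          unfold Literature.NumberTheory.EllipticCurves.cyclotomicExponent; simp]
      decide
    rw [htor, mem_rootsOfUnity] at h
    have h' : ((u : ℤ_[2])) ^ 2 = 1 := by rw [← Units.val_pow_eq_pow_val, h, Units.val_one]
    rcases sq_eq_one_iff.mp h' with h1 | h1
    · exact Or.inl (Units.ext h1)
    · exact Or.inr (Units.ext (by rw [h1, Units.val_neg, Units.val_one]))
  · rintro (rfl | rfl)
    · exact (CommGroup.torsion ℤ_[2]ˣ).one_mem
    · rw [CommGroup.mem_torsion, isOfFinOrder_iff_pow_eq_one]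
      exact ⟨2, two_pos, by rw [neg_one_sq]⟩

end Scalar

/-! ## §4. (C3) abstractly at `p = 2`: `ker κ'` = the elements acting as `±1` -/

section Two

variable {K : Type} [Field K] [NumberField K]

/-- **(C3), ABSTRACT FORM.** `K` imaginary quadratic, `v ≠ v̄` the places above `2`; `Γ_K` acts on a `2`-primary group `M` with elements of
every order `2^k`, by INTEGER SCALARS on each `M[2^k]`, with open stabilisers; the inertia group at every place `w ∣ 2`, `w ≠ v̄` acts
pointwise as `±1`; and SOME `σ₀ ∈ Γ_K` acts neither as `+1` nor as `−1`. Then for every `ℤ₂`-extension `κ'` of `K` unramified outside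
`v̄` and every `σ ∈ Γ_K`: **`σ ∈ ker κ'` iff `σ` acts on `M` as `+1` or as `−1`** — `ker κ' = ψ_M⁻¹(±1)` for the scalar character
`ψ_M : Γ_K →ₜ* ℤ₂ˣ` (`CocyclicScalar.exists_continuousMonoidHom_forall_smul_eq`), by §2 with `μ(ℤ₂) = {±1}`.
[cite: deShalit1987, II §1.9 and §4.17] [cite: SerreAbelianLadic1968, Ch. I §1.2] [cite: Washington1997, §13.1] -/
theorem mem_kerSubgroup_iff_smul_of_scalarAction_two (hK : IsImaginaryQuadratic K)
    {v vbar : HeightOneSpectrum (𝓞 K)} (hv : ((2 : ℕ) : 𝓞 K) ∈ v.asIdeal) (hvbar : ((2 : ℕ) : 𝓞 K) ∈ vbar.asIdeal) (hne : vbar ≠ v)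
    {M : Type*} [AddCommGroup M] [DistribMulAction (absoluteGaloisGroup K) M]
    (hprim : ∀ x : M, ∃ k : ℕ, 2 ^ k • x = 0) (hfull : ∀ k : ℕ, ∃ x : M, addOrderOf x = 2 ^ k)
    (hscal : ∀ (σ : absoluteGaloisGroup K) (k : ℕ), ∃ N : ℤ, ∀ x : M, 2 ^ k • x = 0 → σ • x = N • x)
    (hstab : ∀ x : M, IsOpen {σ : absoluteGaloisGroup K | σ • x = x})
    (hI : ∀ w : HeightOneSpectrum (𝓞 K), ((2 : ℕ) : 𝓞 K) ∈ w.asIdeal → w ≠ vbar →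
      ∀ τ ∈ GreenbergSelmer.inertia w, ∀ x : M, τ • x = x ∨ τ • x = -x)
    (hbig : ∃ σ₀ : absoluteGaloisGroup K, ¬ (∀ x : M, σ₀ • x = x) ∧ ¬ (∀ x : M, σ₀ • x = -x))
    (κ' : ZpExtension K 2) (hκ' : κ'.IsUnramifiedOutside vbar) (σ : absoluteGaloisGroup K) :
    σ ∈ κ'.kerSubgroup ↔ (∀ x : M, σ • x = x) ∨ (∀ x : M, σ • x = -x) := by
  haveI : Fact (Nat.Prime 2) := ⟨Nat.prime_two⟩
  obtain ⟨ψ, hψ⟩ := CocyclicScalar.exists_continuousMonoidHom_forall_smul_eq (p := 2) hscal hfull hstab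
  have hψ' : ∀ (σ : absoluteGaloisGroup K) (k : ℕ) (x : M), 2 ^ k • x = 0 →
      σ • x = (PadicInt.toZModPow k ((ψ : absoluteGaloisGroup K → ℤ_[2]ˣ) σ : ℤ_[2])).val • x := hψ
  -- the hypotheses of §2 for `χ = ψ`
  have hbig' : ∃ σ₀ : absoluteGaloisGroup K, ψ σ₀ ∉ CommGroup.torsion ℤ_[2]ˣ := by
    obtain ⟨σ₀, h1, h2⟩ := hbig
    refine ⟨σ₀, fun hmem => ?_⟩
    rcases (mem_torsion_units_two_iff _).mp hmem with h | h
    · exact h1 ((forall_smul_eq_self_iff hprim hfull hψ' σ₀).mpr h)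
    · exact h2 ((forall_smul_eq_neg_iff hprim hfull hψ' σ₀).mpr h)
  have hI' : ∀ w : HeightOneSpectrum (𝓞 K), ((2 : ℕ) : 𝓞 K) ∈ w.asIdeal → w ≠ vbar →
      ∀ τ ∈ GreenbergSelmer.inertia w, ψ τ ∈ CommGroup.torsion ℤ_[2]ˣ := fun w hw hne' τ hτ =>
    (mem_torsion_units_two_iff _).mpr (eq_one_or_eq_neg_one_of_forall_smul_eq_or hfull hψ' τ (hI w hw hne' τ hτ))
  have hker := kerSubgroup_eq_comap_torsion_of_isUnramifiedOutside hK hv hvbar hne ψ hbig' hI' κ' hκ'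
  rw [hker, Subgroup.mem_comap, mem_torsion_units_two_iff]
  change ψ σ = 1 ∨ ψ σ = -1 ↔ _
  rw [forall_smul_eq_self_iff hprim hfull hψ' σ, forall_smul_eq_neg_iff hprim hfull hψ' σ]

end Two

end Summit.BirchSwinnertonDyer.BirchSwinnertonDyer.Theorems.PrintCf2.LineDecomposition

end
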